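/-
Copyright (c) 2026. All rights reserved.
Released under Apache 2.0 license as described in the file LICENSE.
Authors: abc-iut cell, prover seat abc-iut-L4-t6 (gen 14; cell row S3 «ARC-LTIMES-CARRIER», follow-up to the RQ7 read of
`Ltimes/LogFrobeniusArchGenuinePlusOrb.lean` by abc-iut-L4-d3 (INFO 1): honest limit (L3′) removed), over abc-iut-L4-t3's `TB⊞`
(`PanalocalTheaters.lean`) and abc-iut-w4-d095's category structure (`TBPlusCategory.lean`).
-/
import Literature.AnabelianGeometry.AbsoluteAnabelian.Ltimes.LogFrobeniusArchGenuinePlusOrb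
import HarnessLib

/-!
# [AbsTopIII] §0 / Def 5.6 (i): every object of `TB⊞` has the four `Lie±`-sign automorphisms; the orbit relation of
# `Orb(TB⊞)` is a CONGRUENCE — morphisms of `Orb(TB⊞)` are EXACTLY the `A`-orbits

S. Mochizuki, *Topics in absolute anabelian geometry III: global reconstruction algorithms*, J. Math. Sci. Univ.
Tokyo 22 (2015) 939–1156 [MochizukiAbsTopIII2015]; locators `p.N` = pages of the author's manuscript
(`paper:url-5493eb38cbb7`): §0 p. 28 ("A morphism of pre-orbi-objects `(S₁, A₁) → (S₂, A₂)` is an `A₂`-orbit of morphisms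
`S₁ → S₂` [relative to the action of `A₂` on the codomain] that is closed under the action of `A₁` [on the domain]"), Def 5.6 (i)
p. 134 (`TB⊞`: `B′ × B″ ⥲ B`, the germ isomorphism `β : Lie±(B′) ⥲ Lie±(B″)` "up to `{±1}`"; morphisms compatible with `B′`,
`B″`, `β`).

## What this file proves (removes honest limit (L3′) of `Ltimes/LogFrobeniusArchGenuinePlusOrb.lean`; suggested by the
## non-author RQ7 read of that file, abc-iut-L4-d3 INFO 1)

`TBPlus.Orb` was defined as Mathlib's quotient of `TB⊞` by the congruence GENERATED by the orbit relation `SignRel`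
(`g = f ≫ α`, `α` a `Lie±`-sign automorphism of the codomain), with the caveat that the generated congruence might identify more
than print's orbits.  It does not:

* `TBPlus.param`, `isQuotientMap_param`, `c₁_eq_and_c₂_eq_of_param_eq` — the decomposition `B′ × B″ ⥲ B` of Def 5.6 (i)
  (`B′ ∩ B″ = 0`, `B′ + B″ = B`; `ℝ × ℝ → B` is a quotient map), through which maps out of `B` are defined and shown continuous;
* ★ `TBPlus.signAut M ε₁ ε₂` — **every object of `TB⊞` carries the four sign automorphisms** `c₁(s) + c₂(t) ↦ c₁(ε₁ s) + c₂(ε₂ t)`,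
  `ε₁, ε₂ ∈ {±1}` (rescalings `a₁ = ε₁`, `a₂ = ε₂`, `|ε₂|·β = β·|ε₁|`); `IsSignAut.hom_eq_signAut` — and every `Lie±`-sign
  automorphism IS one of them (a `TB⊞`-morphism is determined by its homomorphism, abc-iut-w4-d095's `hom_ext_toHom`);
* ★ `TBPlus.signAut_hom_comp` — **sign automorphisms push through every morphism**: `α_M(ε) ≫ f = f ≫ α_N(ε)` (a morphism
  rescales the parameters, signs commute with rescalings) — so an `A_N`-orbit is automatically `A_M`-closed, as §0 requires;
* ★★ `TBPlus.signRel_congruence` — `SignRel` is reflexive, symmetric, transitive and stable under pre- and post-composition: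
  a `Congruence`; hence ★★ `TBPlus.toOrb_map_eq_iff` — **two `TB⊞`-morphisms are equal in `Orb(TB⊞)` IFF they lie in one
  `A`-orbit**: the morphisms of `TBPlus.Orb` are EXACTLY print's morphisms of pre-orbi-objects `(M, A_M) → (N, A_N)`;
  `abs_a₁_eq_of_toOrb_map_eq` / `abs_a₂_eq_…` — `Orb(TB⊞)` forgets at most the two signs (abc-iut-L4-d3's probe certificate,
  now a one-line corollary).

Classical bookkeeping on the typed `TB⊞`; refereed pre-IUT material; nothing here bears on [IUTchIII] Cor. 3.12; no side taken;
typed ≠ proved elsewhere.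
-/

set_option autoImplicit false

noncomputable section

universe v

open CategoryTheory Topology

namespace Literature.AnabelianGeometry.AbsoluteAnabelian

namespace TBPlus

variable (M : TBPlus.{v}) {N P : TBPlus.{v}}

/-! ## §1. The decomposition `B = B′ ⊕ B″` and its projections (Def 5.6 (i)) -/

/-- The parametrisation `ℝ × ℝ → B`, `(s, t) ↦ c₁(s) + c₂(t)` (surjective and open by the axioms of `TB⊞`).
[cite: MochizukiAbsTopIII2015, Def 5.6 (i) p. 134] -/
def param (p : ℝ × ℝ) : M.B := M.c₁ p.1 + M.c₂ p.2

/-- The parametrisation is continuous. [cite: MochizukiAbsTopIII2015, Def 5.6 (i) p. 134] -/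
theorem continuous_param : Continuous M.param :=
  (M.c₁.continuous.comp continuous_fst).add (M.c₂.continuous.comp continuous_snd)

/-- The parametrisation is a quotient map (continuous, open, surjective). [cite: MochizukiAbsTopIII2015, Def 5.6 (i) p. 134] -/
theorem isQuotientMap_param : IsQuotientMap M.param :=
  IsOpenMap.isQuotientMap M.isOpenMap_add M.continuous_param M.add_surjective

/-- **`B′ ∩ B″ = 0` in use**: the two components of `c₁(s) + c₂(t)` are determined by the sum.
[cite: MochizukiAbsTopIII2015, Def 5.6 (i) p. 134] -/
theorem c₁_eq_and_c₂_eq_of_param_eq {s t s' t' : ℝ} (h : M.c₁ s + M.c₂ t = M.c₁ s' + M.c₂ t') :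
    M.c₁ s = M.c₁ s' ∧ M.c₂ t = M.c₂ t' := by
  have h1 : M.c₁ (s - s') = M.c₂ (t' - t) := by
    rw [map_sub, map_sub, sub_eq_sub_iff_add_eq_add, h, add_comm]
  have h2 : M.c₁ (s - s') = 0 := M.add_injective _ _ h1
  have h3 : M.c₂ (t' - t) = 0 := by rw [← h1, h2]
  rw [map_sub, sub_eq_zero] at h2 h3
  exact ⟨h2, h3.symm⟩

/-- A chosen pair of parameters of `b ∈ B` (by `B′ × B″ → B` onto). [cite: MochizukiAbsTopIII2015, Def 5.6 (i) p. 134] -/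
def liftPair (b : M.B) : ℝ × ℝ := Function.surjInv M.add_surjective b

/-- The chosen parameters parametrise `b`. [cite: MochizukiAbsTopIII2015, Def 5.6 (i) p. 134] -/
theorem param_liftPair (b : M.B) : M.c₁ (M.liftPair b).1 + M.c₂ (M.liftPair b).2 = b :=
  Function.surjInv_eq M.add_surjective b

/-- A sign does not disturb well-definedness: `c(s) = c(s')` implies `c(ε s) = c(ε s')` for `ε = ±1`. [folklore] -/
private theorem apply_sign_mul_eq (c : ℝ →ₜ+ M.B) {ε : ℝ} (hε : ε = 1 ∨ ε = -1) {s s' : ℝ} (h : c s = c s') :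
    c (ε * s) = c (ε * s') := by
  rcases hε with rfl | rfl
  · rw [one_mul, one_mul, h]
  · rw [neg_one_mul, neg_one_mul, map_neg, map_neg, h]

/-! ## §2. The four `Lie±`-sign automorphisms of every object -/

section Sign

variable (ε₁ ε₂ : ℝ) (h₁ : ε₁ = 1 ∨ ε₁ = -1) (h₂ : ε₂ = 1 ∨ ε₂ = -1)
include h₁ h₂

/-- The sign map is well defined on `B = B′ ⊕ B″`: its value at `c₁(s) + c₂(t)` is `c₁(ε₁ s) + c₂(ε₂ t)` whatever parameters are
chosen. [cite: MochizukiAbsTopIII2015, Def 5.6 (i) p. 134] -/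
theorem sign_welldef {s t s' t' : ℝ} (h : M.c₁ s + M.c₂ t = M.c₁ s' + M.c₂ t') :
    M.c₁ (ε₁ * s) + M.c₂ (ε₂ * t) = M.c₁ (ε₁ * s') + M.c₂ (ε₂ * t') := by
  obtain ⟨hs, ht⟩ := M.c₁_eq_and_c₂_eq_of_param_eq h
  rw [M.apply_sign_mul_eq M.c₁ h₁ hs, M.apply_sign_mul_eq M.c₂ h₂ ht]

/-- **The sign map `c₁(s) + c₂(t) ↦ c₁(ε₁ s) + c₂(ε₂ t)` as a continuous homomorphism `B → B`** (`ε₁` on `B′`, `ε₂` on `B″`;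
continuity through the quotient map `ℝ × ℝ → B`). [cite: MochizukiAbsTopIII2015, Def 5.6 (i) p. 134] -/
def signMap : M.B →ₜ+ M.B where
  toFun b := M.c₁ (ε₁ * (M.liftPair b).1) + M.c₂ (ε₂ * (M.liftPair b).2)
  map_zero' := by
    have h0 : M.c₁ (M.liftPair 0).1 + M.c₂ (M.liftPair 0).2 = M.c₁ 0 + M.c₂ 0 := by
      rw [M.param_liftPair, map_zero, map_zero, add_zero]
    rw [M.sign_welldef ε₁ ε₂ h₁ h₂ h0, mul_zero, mul_zero, map_zero, map_zero, add_zero]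
  map_add' b b' := by
    have h : M.c₁ (M.liftPair (b + b')).1 + M.c₂ (M.liftPair (b + b')).2 =
        M.c₁ ((M.liftPair b).1 + (M.liftPair b').1) + M.c₂ ((M.liftPair b).2 + (M.liftPair b').2) := by
      rw [M.param_liftPair, map_add, map_add, add_add_add_comm, M.param_liftPair, M.param_liftPair]
    rw [M.sign_welldef ε₁ ε₂ h₁ h₂ h, mul_add, mul_add, map_add, map_add, add_add_add_comm]
  continuous_toFun := by
    have hq := M.isQuotientMap_param
    refine hq.continuous_iff.2 ?_
    have heq : (fun b => M.c₁ (ε₁ * (M.liftPair b).1) + M.c₂ (ε₂ * (M.liftPair b).2)) ∘ M.param =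
        fun p : ℝ × ℝ => M.c₁ (ε₁ * p.1) + M.c₂ (ε₂ * p.2) := by
      funext p
      exact M.sign_welldef ε₁ ε₂ h₁ h₂ (M.param_liftPair (M.param p))
    rw [heq]
    exact (M.c₁.continuous.comp (continuous_const.mul continuous_fst)).add
      (M.c₂.continuous.comp (continuous_const.mul continuous_snd))

/-- The sign map on parameters. [cite: MochizukiAbsTopIII2015, Def 5.6 (i) p. 134] -/
theorem signMap_param (s t : ℝ) :
    M.signMap ε₁ ε₂ h₁ h₂ (M.c₁ s + M.c₂ t) = M.c₁ (ε₁ * s) + M.c₂ (ε₂ * t) :=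
  M.sign_welldef ε₁ ε₂ h₁ h₂ (M.param_liftPair (M.c₁ s + M.c₂ t))

/-- The sign map is an involution (`ε² = 1`). [cite: MochizukiAbsTopIII2015, Def 5.6 (i) p. 134] -/
theorem signMap_signMap (b : M.B) : M.signMap ε₁ ε₂ h₁ h₂ (M.signMap ε₁ ε₂ h₁ h₂ b) = b := by
  obtain ⟨⟨s, t⟩, rfl⟩ := M.add_surjective b
  change M.signMap ε₁ ε₂ h₁ h₂ (M.signMap ε₁ ε₂ h₁ h₂ (M.c₁ s + M.c₂ t)) = M.c₁ s + M.c₂ t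
  rw [signMap_param, signMap_param, ← mul_assoc, ← mul_assoc]
  have e₁ : ε₁ * ε₁ = 1 := by rcases h₁ with rfl | rfl <;> norm_num
  have e₂ : ε₂ * ε₂ = 1 := by rcases h₂ with rfl | rfl <;> norm_num
  rw [e₁, e₂, one_mul, one_mul]

/-- **The sign map as a morphism of `TB⊞`**: rescalings `a₁ = ε₁`, `a₂ = ε₂`; `|ε₂|·β = β·|ε₁|`.
[cite: MochizukiAbsTopIII2015, Def 5.6 (i) p. 134] -/
def signHom : M ⟶ M where
  toHom := M.signMap ε₁ ε₂ h₁ h₂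
  surjective b := ⟨M.signMap ε₁ ε₂ h₁ h₂ b, M.signMap_signMap ε₁ ε₂ h₁ h₂ b⟩
  a₁ := ε₁
  a₂ := ε₂
  map_c₁ s := by
    have h : M.c₁ s = M.c₁ s + M.c₂ 0 := by rw [map_zero, add_zero]
    change M.signMap ε₁ ε₂ h₁ h₂ (M.c₁ s) = _
    rw [h, signMap_param, mul_zero, map_zero, add_zero]
  map_c₂ t := by
    have h : M.c₂ t = M.c₁ 0 + M.c₂ t := by rw [map_zero, zero_add]
    change M.signMap ε₁ ε₂ h₁ h₂ (M.c₂ t) = _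
    rw [h, signMap_param, mul_zero, map_zero, zero_add]
  map_β := by
    have a₁ : |ε₁| = 1 := by rcases h₁ with rfl | rfl <;> norm_num
    have a₂ : |ε₂| = 1 := by rcases h₂ with rfl | rfl <;> norm_num
    rw [a₁, a₂, one_mul, mul_one]

/-- ★ **Every object of `TB⊞` carries the four `Lie±`-sign automorphisms** `(ε₁, ε₂) ∈ {±1}²`.
[cite: MochizukiAbsTopIII2015, Def 5.6 (i) p. 134] -/
def signAut : M ≅ M :=
  isoMk (M.signHom ε₁ ε₂ h₁ h₂) (M.signHom ε₁ ε₂ h₁ h₂) (M.signMap_signMap ε₁ ε₂ h₁ h₂) (M.signMap_signMap ε₁ ε₂ h₁ h₂)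

/-- Its rescalings. [cite: MochizukiAbsTopIII2015, Def 5.6 (i) p. 134] -/
theorem signAut_hom_a₁ : (M.signAut ε₁ ε₂ h₁ h₂).hom.a₁ = ε₁ := rfl

/-- Its rescalings. [cite: MochizukiAbsTopIII2015, Def 5.6 (i) p. 134] -/
theorem signAut_hom_a₂ : (M.signAut ε₁ ε₂ h₁ h₂).hom.a₂ = ε₂ := rfl

/-- It is a `Lie±`-sign automorphism in the sense of `IsSignAut`. [cite: MochizukiAbsTopIII2015, Def 5.6 (i) p. 134] -/
theorem isSignAut_signAut : IsSignAut (M.signAut ε₁ ε₂ h₁ h₂) := ⟨h₁, h₂⟩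

/-- ★ **Sign automorphisms push through every morphism of `TB⊞`**: `α_M(ε₁, ε₂) ≫ f = f ≫ α_N(ε₁, ε₂)` — on `c₁(s) + c₂(t)` both
sides give `c₁′(a₁ ε₁ s) + c₂′(a₂ ε₂ t)`.  (So an `A_N`-orbit of morphisms `M → N` is automatically closed under `A_M`, §0.)
[cite: MochizukiAbsTopIII2015, §0 p. 28] -/
theorem signAut_hom_comp (N : TBPlus.{v}) (f : M ⟶ N) :
    (M.signAut ε₁ ε₂ h₁ h₂).hom ≫ f = f ≫ (N.signAut ε₁ ε₂ h₁ h₂).hom := by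
  refine hom_ext_toHom (ContinuousAddMonoidHom.ext fun b => ?_)
  obtain ⟨⟨s, t⟩, rfl⟩ := M.add_surjective b
  change f.toHom (M.signMap ε₁ ε₂ h₁ h₂ (M.c₁ s + M.c₂ t)) = N.signMap ε₁ ε₂ h₁ h₂ (f.toHom (M.c₁ s + M.c₂ t))
  rw [signMap_param, map_add, map_add, f.map_c₁, f.map_c₂, f.map_c₁, f.map_c₂, signMap_param]
  have e1 : f.a₁ * (ε₁ * s) = ε₁ * (f.a₁ * s) := by ring
  have e2 : f.a₂ * (ε₂ * t) = ε₂ * (f.a₂ * t) := by ring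
  rw [e1, e2]

end Sign

/-- **Every `Lie±`-sign automorphism IS one of the four canonical ones** (a morphism of `TB⊞` is determined by its homomorphism,
which is determined by its values on `B′` and `B″`). [cite: MochizukiAbsTopIII2015, Def 5.6 (i) p. 134] -/
theorem IsSignAut.hom_eq_signAut {α : N ≅ N} (hα : IsSignAut α) :
    α.hom = (N.signAut α.hom.a₁ α.hom.a₂ hα.1 hα.2).hom := by
  refine hom_ext_toHom (ContinuousAddMonoidHom.ext fun b => ?_)
  obtain ⟨⟨s, t⟩, rfl⟩ := N.add_surjective b
  change α.hom.toHom (N.c₁ s + N.c₂ t) = N.signMap α.hom.a₁ α.hom.a₂ hα.1 hα.2 (N.c₁ s + N.c₂ t)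
  rw [map_add, α.hom.map_c₁, α.hom.map_c₂, signMap_param]

/-- Hence every sign automorphism pushes through every morphism. [cite: MochizukiAbsTopIII2015, §0 p. 28] -/
theorem IsSignAut.exists_comp_eq {α : N ≅ N} (hα : IsSignAut α) (f : N ⟶ P) :
    ∃ α' : P ≅ P, IsSignAut α' ∧ α.hom ≫ f = f ≫ α'.hom :=
  ⟨P.signAut α.hom.a₁ α.hom.a₂ hα.1 hα.2, P.isSignAut_signAut _ _ hα.1 hα.2,
    (congrArg (· ≫ f) hα.hom_eq_signAut).trans (N.signAut_hom_comp _ _ hα.1 hα.2 P f)⟩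

/-- The inverse of a sign automorphism is a sign automorphism. [cite: MochizukiAbsTopIII2015, Def 5.6 (i) p. 134] -/
theorem IsSignAut.symm {α : N ≅ N} (hα : IsSignAut α) : IsSignAut α.symm := by
  obtain ⟨ha₁, ha₂⟩ := hα
  have i₁ := Iso.inv_a₁_mul_hom_a₁ α
  have i₂ := Iso.inv_a₂_mul_hom_a₂ α
  refine ⟨?_, ?_⟩
  · change α.inv.a₁ = 1 ∨ α.inv.a₁ = -1
    rcases ha₁ with h | h <;> rw [h] at i₁
    · exact Or.inl (by rwa [mul_one] at i₁)
    · exact Or.inr (by rw [mul_neg_one] at i₁; rw [← i₁, neg_neg])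
  · change α.inv.a₂ = 1 ∨ α.inv.a₂ = -1
    rcases ha₂ with h | h <;> rw [h] at i₂
    · exact Or.inl (by rwa [mul_one] at i₂)
    · exact Or.inr (by rw [mul_neg_one] at i₂; rw [← i₂, neg_neg])

/-- Sign automorphisms compose. [cite: MochizukiAbsTopIII2015, Def 5.6 (i) p. 134] -/
theorem IsSignAut.trans {α β : N ≅ N} (hα : IsSignAut α) (hβ : IsSignAut β) : IsSignAut (α ≪≫ β) := by
  obtain ⟨ha₁, ha₂⟩ := hα
  obtain ⟨hb₁, hb₂⟩ := hβ
  refine ⟨?_, ?_⟩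
  · change (α.hom ≫ β.hom).a₁ = 1 ∨ (α.hom ≫ β.hom).a₁ = -1
    rw [comp_a₁]
    rcases ha₁ with h | h <;> rcases hb₁ with h' | h' <;> rw [h, h'] <;> norm_num
  · change (α.hom ≫ β.hom).a₂ = 1 ∨ (α.hom ≫ β.hom).a₂ = -1
    rw [comp_a₂]
    rcases ha₂ with h | h <;> rcases hb₂ with h' | h' <;> rw [h, h'] <;> norm_num

/-! ## §3. `SignRel` is a congruence: the morphisms of `Orb(TB⊞)` are EXACTLY the `A`-orbits (§0) -/

/-- ★★ **§0's orbit relation on `TB⊞` is a CONGRUENCE**: an equivalence relation on every hom-set (identity, inverse and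
composite of sign automorphisms), stable under precomposition (trivially) and under postcomposition (sign automorphisms push
through every morphism, `IsSignAut.exists_comp_eq`). [cite: MochizukiAbsTopIII2015, §0 p. 28] -/
theorem signRel_congruence : Congruence SignRel.{v} where
  comp_left f g g' := by
    rintro ⟨α, hα, rfl⟩
    exact ⟨α, hα, (Category.assoc _ _ _).symm⟩
  comp_right {X Y Z f f'} g := by
    rintro ⟨α, hα, rfl⟩
    obtain ⟨α', hα', hcomp⟩ := hα.exists_comp_eq g
    exact ⟨α', hα', by rw [Category.assoc, hcomp, Category.assoc]⟩
  equivalence :=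
    { refl := fun f => ⟨Iso.refl _, isSignAut_refl _, (Category.comp_id f).symm⟩
      symm := by
        rintro f g ⟨α, hα, rfl⟩
        exact ⟨α.symm, hα.symm, by simp⟩
      trans := by
        rintro f g h ⟨α, hα, rfl⟩ ⟨β, hβ, rfl⟩
        exact ⟨α ≪≫ β, hα.trans hβ, by simp⟩ }

/-- ★★ **Morphisms of `Orb(TB⊞)` are EXACTLY print's morphisms of pre-orbi-objects**: two `TB⊞`-morphisms `M → N` are equal in
`Orb(TB⊞)` if and only if they lie in one `A_N`-orbit (the generated congruence adds nothing — honest limit (L3′) of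
`Ltimes/LogFrobeniusArchGenuinePlusOrb.lean` removed). [cite: MochizukiAbsTopIII2015, §0 p. 28] -/
theorem toOrb_map_eq_iff {M N : TBPlus.{v}} (f g : M ⟶ N) : toOrb.map f = toOrb.map g ↔ SignRel f g := by
  haveI := signRel_congruence.{v}
  exact CategoryTheory.Quotient.functor_map_eq_iff _ f g

/-- `Orb(TB⊞)` forgets at most the two signs: morphisms equal in `Orb` have rescalings of the same absolute values (the
`Lie±`-content `|a₁|`, `|a₂|` survives) — abc-iut-L4-d3's probe certificate as a corollary.
[cite: MochizukiAbsTopIII2015, Def 5.6 (i) p. 134] -/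
theorem abs_a₁_eq_and_abs_a₂_eq_of_toOrb_map_eq {M N : TBPlus.{v}} {f g : M ⟶ N} (h : toOrb.map f = toOrb.map g) :
    |f.a₁| = |g.a₁| ∧ |f.a₂| = |g.a₂| := by
  obtain ⟨α, ⟨ha₁, ha₂⟩, rfl⟩ := (toOrb_map_eq_iff f g).1 h
  rw [comp_a₁, comp_a₂, abs_mul, abs_mul]
  have e₁ : |α.hom.a₁| = 1 := by rcases ha₁ with h | h <;> rw [h] <;> norm_num
  have e₂ : |α.hom.a₂| = 1 := by rcases ha₂ with h | h <;> rw [h] <;> norm_num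
  rw [e₁, e₂, one_mul, one_mul]
  exact ⟨rfl, rfl⟩

end TBPlus

end Literature.AnabelianGeometry.AbsoluteAnabelian

end
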